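import Summits.QuantumFields.BalabanUV.T4Continuum.Support.NE3AxialGaugeLadder
import Summits.QuantumFields.BalabanUV.T4Continuum.Support.AveragingDeficitFermat
import HarnessLib

/-!
# NE7BlockAxialGauge — BRICK N1 (first half) OF THE REP♭ ROAD: THE BLOCK-ROOTED AXIAL GAUGE ON THE PERIODIC LATTICE, PINNED AT THE BLOCK CORNERS,
# WITH ITS LINK LETTERS — intra-block links within `(d+1)(M−1)·ε` of `1`, face-crossing links within `(M+1)(d+1)(M−1)·ε` of the CORNER-SEGMENT transporter

Cell `pub-balaban`, sub-cell t4, lineage `b2b-balaban-t4-ne7-p1`, gen 73 (CRUX PROVER NE7 #1).  Memo `t4/b2b-balaban-t4-ne7-p1-g73/REP-FLAT-ROAD-v2.md` §2 step 0: the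
multi-level sup induction for REP♭ starts from the hierarchical axial gauge pinned at the top corners `M•ℤ^{d+1}` (so `cavgIter` is unchanged,
`NE3CpushGaugeCovariance.cavgIter_gaugeAct`).  THIS FILE builds it on the periodic lattice from lit-balaban's one-root tree gauge `B7Prop1Explicit.axialFn`
(root = the corner `⌊x⌋ := (x_i − x_i mod M)_i` of the block of `x`; written inline, no definition) and proves its link letters from the plaquette radius ALONE:
(i) a link inside a block is the one-root tree-gauge link, within `|x − ⌊x⌋|₁·ε` of `1` (`B7Prop1Explicit.axial_bond_bound`); (ii) a link crossing the face
`x_κ ≡ M − 1` equals the corner-segment transporter `U(⌊x⌋; [⌊x⌋, ⌊x⌋ + Me_κ])` of its face up to the one-root defect and an `M`-rung ladder over the high part of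
the tree word (§3 `norm_piLoop_sub_one_le`, induction on `M` through `B7Prop1Explicit.ladder_bound`); (iii) corner segments read the same in `U` and `U^{u}`.  The
corner segments are what the DATUM controls (top level: the fibre constraint; level `j`: the `j`-fold average) — the second half of N1, not here.
WHAT ([folklore]; 0 def, 0 sorry): §1 `emod` bookkeeping of `⌊x⌋`; §2 the gauge (pinned `gauge_corner`, `gauge_periodic`, `gauge_unitary`; `link_inside_eq`,
`hol_seg_corner_eq`, `treeWord_add_of_separated'`, `link_face_eq`); §3 `norm_piLoop_sub_one_le`; §4 `norm_link_inside_le`, `norm_link_face_sub_seg_le`; §5 END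
**`exists_blockAxialGauge`**.  HONEST FRAMING: kinematics of the axial gauge — [B7] pp. 24–25 ∕ [B8] Lemma 1 p. 79 are TEXT LOCATIONS, nothing printed is
asserted; no datum, no average, no Landau gauge here; REP♭ NOT proved; (APE) at the trivial flat datum conditional on it; NOT NE7; spine 0∕9; finite T⁴ rung (B)+1 —
NOT infinite volume, NOT mass gap, NOT BetaPertH, NOT Clay.  Continuum YM on T⁴ ⇐ BetaPertH ∧ nine spine estimates (0/9 proved); BetaPertH ⇐ (D1) ∧ (D4) ∧ CAP+tail.
-/

set_option autoImplicit false

open scoped BigOperators Matrix Matrix.Norms.L2Operator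
open Finset

namespace Summit.QuantumFields.BalabanUV.T4Continuum.NE7BlockAxialGauge

open Literature.MathematicalPhysics.QuantumFieldTheory.Balaban1983to89
open B7Prop1Explicit B7Prop2Explicit
open T4AveragingDeficitWall (IsUnitaryCfg SmallField)
open T4AveragingDeficitWallBoundary (IsPeriodicCfg)
open T4AveragingDeficitNonAbelian (hol_add_period)
open AveragingDeficitTransport (mem_U1_of_unitary)
open NE3AxialGaugeLadder (treeWord_add_of_separated)

noncomputable section

variable {d : ℕ}
/-! ## §1 The block corner `⌊x⌋_i = x_i − x_i mod M` -/

section Corner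

variable (M : ℕ) [NeZero M]

/-- `0 ≤ x_i mod M`. [folklore] -/
theorem emod_nonneg' (x : Site (d + 1)) (i : Fin (d + 1)) : 0 ≤ x i % (M : ℤ) := Int.emod_nonneg _ (by exact_mod_cast NeZero.ne M)
/-- `x_i mod M < M`. [folklore] -/
theorem emod_lt' (x : Site (d + 1)) (i : Fin (d + 1)) : x i % (M : ℤ) < M := Int.emod_lt_of_pos _ (by exact_mod_cast Nat.pos_of_ne_zero (NeZero.ne M))
omit [NeZero M] in
/-- `x_i − x_i mod M = M·(x_i div M)`. [folklore] -/
theorem sub_emod_eq (x : Site (d + 1)) (i : Fin (d + 1)) : x i - x i % (M : ℤ) = (M : ℤ) * (x i / (M : ℤ)) := by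
  have := Int.mul_ediv_add_emod (x i) (M : ℤ); linarith
omit [NeZero M] in
/-- the coordinates of a corner are multiples of `M`. [folklore] -/
theorem corner_emod (x : Site (d + 1)) (j : Fin (d + 1)) : (x j - x j % (M : ℤ)) % (M : ℤ) = 0 := by
  rw [sub_emod_eq, Int.mul_emod_right]
omit [NeZero M] in
/-- … also after a shift by `M•e_κ`. [folklore] -/
theorem corner_shift_emod (x : Site (d + 1)) (κ j : Fin (d + 1)) :
    ((fun i => x i - x i % (M : ℤ)) + (M : ℤ) • e κ) j % (M : ℤ) = 0 := by
  simp only [Pi.add_apply, Pi.smul_apply, smul_eq_mul]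
  rw [sub_emod_eq, ← mul_add, Int.mul_emod_right]
omit [NeZero M] in
/-- the corner is constant along a period shift: `⌊x + P•e_i⌋ = ⌊x⌋ + P•e_i` when `M ∣ P`. [folklore] -/
theorem corner_add_period (x : Site (d + 1)) {P : ℤ} (hP : (M : ℤ) ∣ P) (i : Fin (d + 1)) :
    (fun j => (x + P • e i) j - (x + P • e i) j % (M : ℤ)) = (fun j => x j - x j % (M : ℤ)) + P • e i := by
  obtain ⟨q, hq⟩ := hP
  funext j
  simp only [Pi.add_apply, Pi.smul_apply, smul_eq_mul, e_apply]
  split_ifs with h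
  · rw [mul_one, hq, Int.add_mul_emod_self_left]; ring
  · rw [mul_zero, add_zero, add_zero]

/-- `|x − ⌊x⌋|₁ ≤ (d+1)(M−1)`. [folklore] -/
theorem l1_sub_corner_le (x : Site (d + 1)) : (l1 (x - fun j => x j - x j % (M : ℤ)) : ℝ) ≤ ((d + 1 : ℕ) : ℝ) * ((M : ℝ) - 1) := by
  unfold l1
  have hterm : ∀ i : Fin (d + 1), ((((x - fun j => x j - x j % (M : ℤ)) i).natAbs : ℕ) : ℝ) ≤ (M : ℝ) - 1 := by
    intro i
    rw [show (x - fun j => x j - x j % (M : ℤ)) i = x i % (M : ℤ) by simp]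
    have h0 := emod_nonneg' M x i
    have h1 := emod_lt' M x i
    have hcast : (((x i % (M : ℤ)).natAbs : ℕ) : ℝ) = ((x i % (M : ℤ) : ℤ) : ℝ) := by
      rw [← Int.cast_natCast, Int.natAbs_of_nonneg h0]
    rw [hcast]
    have hz : x i % (M : ℤ) ≤ (M : ℤ) - 1 := by omega
    have hr : ((x i % (M : ℤ) : ℤ) : ℝ) ≤ (((M : ℤ) - 1 : ℤ) : ℝ) := Int.cast_le.mpr hz
    push_cast at hr
    exact hr
  calc (((∑ i, ((x - fun j => x j - x j % (M : ℤ)) i).natAbs : ℕ) : ℝ))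
      = ∑ i, ((((x - fun j => x j - x j % (M : ℤ)) i).natAbs : ℕ) : ℝ) := by push_cast; rfl
    _ ≤ ∑ _i : Fin (d + 1), ((M : ℝ) - 1) := Finset.sum_le_sum fun i _ => hterm i
    _ = ((d + 1 : ℕ) : ℝ) * ((M : ℝ) - 1) := by rw [Finset.sum_const, Finset.card_univ, Fintype.card_fin, nsmul_eq_mul]

/-- a step INSIDE the block keeps the corner: if `x_κ mod M ≠ M − 1` then `⌊x + e_κ⌋ = ⌊x⌋`. [folklore] -/
theorem corner_add_e_of_ne (x : Site (d + 1)) (κ : Fin (d + 1)) (h : x κ % (M : ℤ) ≠ (M : ℤ) - 1) :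
    (fun j => (x + e κ) j - (x + e κ) j % (M : ℤ)) = (fun j => x j - x j % (M : ℤ)) := by
  funext j
  simp only [Pi.add_apply, e_apply]
  split_ifs with hj
  · rw [hj]
    have h0 := emod_nonneg' M x κ
    have h1 := emod_lt' M x κ
    have hlt : x κ % (M : ℤ) + 1 < (M : ℤ) := by omega
    have hdec : x κ + 1 = (x κ % (M : ℤ) + 1) + (M : ℤ) * (x κ / (M : ℤ)) := by
      have := Int.mul_ediv_add_emod (x κ) (M : ℤ); linarith
    have hmod : (x κ + 1) % (M : ℤ) = x κ % (M : ℤ) + 1 := by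
      rw [hdec, Int.add_mul_emod_self_left, Int.emod_eq_of_lt (by omega) hlt]
    rw [hmod]; ring
  · rw [add_zero]
omit [NeZero M] in
/-- a step ACROSS the face moves the corner by `M•e_κ`: if `x_κ mod M = M − 1` then `⌊x + e_κ⌋ = ⌊x⌋ + M•e_κ`. [folklore] -/
theorem corner_add_e_of_eq (x : Site (d + 1)) (κ : Fin (d + 1)) (h : x κ % (M : ℤ) = (M : ℤ) - 1) :
    (fun j => (x + e κ) j - (x + e κ) j % (M : ℤ)) = (fun j => x j - x j % (M : ℤ)) + (M : ℤ) • e κ := by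
  funext j
  simp only [Pi.add_apply, Pi.smul_apply, smul_eq_mul, e_apply]
  split_ifs with hj
  · rw [hj]
    have hdec : x κ + 1 = 0 + (M : ℤ) * (x κ / (M : ℤ) + 1) := by
      have := Int.mul_ediv_add_emod (x κ) (M : ℤ); rw [h] at this; linarith
    have hmod : (x κ + 1) % (M : ℤ) = 0 := by
      rw [hdec, Int.add_mul_emod_self_left, Int.zero_emod]
    rw [hmod, h]; ring
  · rw [mul_zero, add_zero, add_zero]

end Corner

/-! ## §2 The block-rooted axial gauge `u(x) = U(Γ_{⌊x⌋, x})`: pinned, periodic, unitary -/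

section Gauge

variable {n : Type} [Fintype n] [DecidableEq n]
variable (M : ℕ)

/-- the gauge is `1` at every point whose coordinates are multiples of `M`. [folklore] -/
theorem gauge_at_corner' (U : Site (d + 1) → Fin (d + 1) → (Matrix n n ℂ)ˣ) (y : Site (d + 1)) (hy : ∀ j, y j % (M : ℤ) = 0) :
    axialFn U (fun j => y j - y j % (M : ℤ)) y = 1 := by
  have : (fun j => y j - y j % (M : ℤ)) = y := by funext j; rw [hy j, sub_zero]
  rw [this, axialFn, sub_self, treeWord_zero, hol_nil]

/-- PINNED AT THE CORNERS: `u(M•y) = 1`. [folklore] -/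
theorem gauge_corner (U : Site (d + 1) → Fin (d + 1) → (Matrix n n ℂ)ˣ) (y : Site (d + 1)) :
    axialFn U (fun i => ((M : ℤ) • y) i - ((M : ℤ) • y) i % (M : ℤ)) ((M : ℤ) • y) = 1 :=
  gauge_at_corner' M U _ fun j => by simp [Pi.smul_apply, Int.mul_emod_right]

/-- PERIODIC: if `U` is `P`-periodic with `M ∣ P` then `u(x + P•e_i) = u(x)`. [folklore] -/
theorem gauge_periodic {U : Site (d + 1) → Fin (d + 1) → (Matrix n n ℂ)ˣ} {P : ℤ} (hUP : IsPeriodicCfg U P) (hMP : (M : ℤ) ∣ P)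
    (x : Site (d + 1)) (i : Fin (d + 1)) :
    axialFn U (fun j => (x + P • e i) j - (x + P • e i) j % (M : ℤ)) (x + P • e i)
      = axialFn U (fun j => x j - x j % (M : ℤ)) x := by
  rw [axialFn, axialFn, corner_add_period M x hMP i]
  have hv : x + P • e i - ((fun j => x j - x j % (M : ℤ)) + P • e i) = x - fun j => x j - x j % (M : ℤ) := by abel
  rw [hv, hol_add_period hUP i]

/-- UNITARY: `u(x)` is a product of link variables. [folklore] -/
theorem gauge_unitary {U : Site (d + 1) → Fin (d + 1) → (Matrix n n ℂ)ˣ} (hU : IsUnitaryCfg U) (x : Site (d + 1)) :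
    axialFn U (fun j => x j - x j % (M : ℤ)) x ∈ unitaryUnits (Matrix n n ℂ) :=
  hol_mem_of (S := unitaryUnits (Matrix n n ℂ)) hU _ _

/-- inside a block the block-rooted gauge acts on the link `(x, κ)` as the one-root tree gauge at `⌊x⌋`. [folklore] -/
theorem link_inside_eq [NeZero M] (U : Site (d + 1) → Fin (d + 1) → (Matrix n n ℂ)ˣ) (x : Site (d + 1)) (κ : Fin (d + 1))
    (h : x κ % (M : ℤ) ≠ (M : ℤ) - 1) :
    gaugeAct (fun z => axialFn U (fun j => z j - z j % (M : ℤ)) z) U x κ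
      = gaugeAct (axialFn U (fun j => x j - x j % (M : ℤ))) U x κ := by
  simp only [gaugeAct]
  rw [corner_add_e_of_ne M x κ h]

/-- **THE CORNER SEGMENT IS READ THE SAME IN `U` AND IN `U^{u}`**: `U^{u}(⌊x⌋; [⌊x⌋, ⌊x⌋ + Me_κ]) = U(⌊x⌋; [⌊x⌋, ⌊x⌋ + Me_κ])` (the gauge is `1` at both
ends). [folklore] -/
theorem hol_seg_corner_eq (U : Site (d + 1) → Fin (d + 1) → (Matrix n n ℂ)ˣ) (x : Site (d + 1)) (κ : Fin (d + 1)) :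
    hol (gaugeAct (fun z => axialFn U (fun j => z j - z j % (M : ℤ)) z) U) (fun i => x i - x i % (M : ℤ)) (seg κ (M : ℤ))
      = hol U (fun i => x i - x i % (M : ℤ)) (seg κ (M : ℤ)) := by
  have h1 : axialFn U (fun j => (fun i => x i - x i % (M : ℤ)) j - (fun i => x i - x i % (M : ℤ)) j % (M : ℤ)) (fun i => x i - x i % (M : ℤ)) = 1 :=
    gauge_at_corner' M U _ fun j => corner_emod M x j
  have h2 : axialFn U (fun j => ((fun i => x i - x i % (M : ℤ)) + (M : ℤ) • e κ) j - ((fun i => x i - x i % (M : ℤ)) + (M : ℤ) • e κ) j % (M : ℤ))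
      ((fun i => x i - x i % (M : ℤ)) + (M : ℤ) • e κ) = 1 :=
    gauge_at_corner' M U _ fun j => corner_shift_emod M x κ j
  rw [hol_gaugeAct, disp_seg]
  exact (congrArg₂ (fun a b => a * hol U (fun i => x i - x i % (M : ℤ)) (seg κ (M : ℤ)) * b⁻¹) h1 h2).trans (by rw [inv_one, mul_one, one_mul])

/-- separated tree words concatenate (variant of `NE3AxialGaugeLadder.treeWord_add_of_separated` with the separating coordinate carried by the LOW word):
`u` supported on `{j : μ < j}`, `v` on `{j : j ≤ μ}`. [folklore] -/
theorem treeWord_add_of_separated' (μ : Fin (d + 1)) {u v : Site (d + 1)} (hu : ∀ κ, κ ≤ μ → u κ = 0) (hv : ∀ κ, μ < κ → v κ = 0) :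
    treeWord u ++ treeWord v = treeWord (u + v) := by
  obtain ⟨s, t, hst⟩ := List.append_of_mem (a := μ) (l := (List.finRange (d + 1)).reverse) (by simp)
  have hpw := B8Lemma1NonAbelian.pairwise_gt_finRange_reverse (d + 1)
  rw [hst] at hpw
  have hs : ∀ κ ∈ s, μ < κ := fun κ hκ => (List.pairwise_append.mp hpw).2.2 κ hκ μ (by simp)
  have ht : ∀ κ ∈ t, κ < μ := fun κ hκ => List.rel_of_pairwise_cons (List.pairwise_append.mp hpw).2.1 hκ
  unfold treeWord
  rw [hst]
  simp only [List.flatMap_append, List.flatMap_cons, Pi.add_apply]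
  have e1 : t.flatMap (fun κ => seg κ (u κ)) = [] := List.flatMap_eq_nil_iff.mpr fun κ hκ => by rw [hu κ (ht κ hκ).le, seg_zero]
  have e2 : s.flatMap (fun κ => seg κ (v κ)) = [] := List.flatMap_eq_nil_iff.mpr fun κ hκ => by rw [hv κ (hs κ hκ), seg_zero]
  have e3 : seg μ (u μ) = [] := by rw [hu μ le_rfl, seg_zero]
  have e4 : s.flatMap (fun κ => seg κ (u κ + v κ)) = s.flatMap (fun κ => seg κ (u κ)) :=
    flatMap_congr_of (s := s) fun κ hκ => by rw [hv κ (hs κ hκ), add_zero]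
  have e5 : t.flatMap (fun κ => seg κ (u κ + v κ)) = t.flatMap (fun κ => seg κ (v κ)) :=
    flatMap_congr_of (s := t) fun κ hκ => by rw [hu κ (ht κ hκ).le, zero_add]
  rw [e1, e2, e3, e4, e5, hu μ le_rfl, zero_add]
  simp

/-- **FACE LINK IDENTITY**: on the face `x_κ mod M = M − 1`, with `y = ⌊x⌋`, `y′ = y + Me_κ`, `hi` the part of `x − y` above `κ` and `T = tree(hi)`:
`U^{u}(x, κ) = U^{axial_y}(x, κ) · [U(y; T)·U(y + hi; seg_M)·U(y′; T)⁻¹·U(y; seg_M)⁻¹] · U(y; seg_M)`. [folklore] -/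
theorem link_face_eq [NeZero M] (U : Site (d + 1) → Fin (d + 1) → (Matrix n n ℂ)ˣ) (x : Site (d + 1)) (κ : Fin (d + 1))
    (h : x κ % (M : ℤ) = (M : ℤ) - 1) :
    gaugeAct (fun z => axialFn U (fun j => z j - z j % (M : ℤ)) z) U x κ
      = gaugeAct (axialFn U (fun j => x j - x j % (M : ℤ))) U x κ
        * (hol U (fun j => x j - x j % (M : ℤ)) (treeWord (fun j => if κ < j then x j % (M : ℤ) else 0))
            * hol U ((fun j => x j - x j % (M : ℤ)) + disp (treeWord (fun j => if κ < j then x j % (M : ℤ) else (0 : ℤ)))) (seg κ (M : ℤ))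
            * (hol U ((fun j => x j - x j % (M : ℤ)) + (M : ℤ) • e κ) (treeWord (fun j => if κ < j then x j % (M : ℤ) else 0)))⁻¹
            * (hol U (fun j => x j - x j % (M : ℤ)) (seg κ (M : ℤ)))⁻¹)
        * hol U (fun j => x j - x j % (M : ℤ)) (seg κ (M : ℤ)) := by
  have hcorner : (fun j => (x + e κ) j - (x + e κ) j % (M : ℤ)) = (fun j => x j - x j % (M : ℤ)) + (M : ℤ) • e κ := corner_add_e_of_eq M x κ h
  simp only [gaugeAct]
  rw [hcorner]
  set y : Site (d + 1) := fun j => x j - x j % (M : ℤ) with hy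
  set hi : Site (d + 1) := fun j => if κ < j then x j % (M : ℤ) else 0 with hhi
  set lo : Site (d + 1) := fun j => if j < κ then x j % (M : ℤ) else 0 with hlo
  -- the two offsets of `x + e_κ`
  have hoff1 : x + e κ - y = hi + ((M : ℤ) • e κ + lo) := by
    funext j
    simp only [hy, hhi, hlo, Pi.add_apply, Pi.sub_apply, Pi.smul_apply, smul_eq_mul, e_apply]
    by_cases hj : j = κ
    · rw [hj]; simp [h]
    · rcases lt_or_gt_of_ne hj with hlt | hgt
      · simp [hj, hlt, lt_asymm hlt]
      · simp [hj, hgt, lt_asymm hgt]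
  have hoff2 : x + e κ - (y + (M : ℤ) • e κ) = hi + lo := by
    have : x + e κ - (y + (M : ℤ) • e κ) = (x + e κ - y) - (M : ℤ) • e κ := by abel
    rw [this, hoff1]; abel
  -- separations
  have hhi0 : ∀ j, j ≤ κ → hi j = 0 := fun j hj => by simp only [hhi, if_neg (not_lt.mpr hj)]
  have hlo0 : ∀ j, κ ≤ j → lo j = 0 := fun j hj => by simp only [hlo, if_neg (not_lt.mpr hj)]
  have hMlo : ∀ j, κ < j → ((M : ℤ) • e κ + lo) j = 0 := fun j hj => by
    simp only [Pi.add_apply, Pi.smul_apply, smul_eq_mul, e_apply, if_neg (ne_of_gt hj), mul_zero, zero_add]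
    exact hlo0 j hj.le
  have hMe : ∀ j, j < κ → ((M : ℤ) • e κ : Site (d + 1)) j = 0 := fun j hj => by
    simp only [Pi.smul_apply, smul_eq_mul, e_apply, if_neg (ne_of_lt hj), mul_zero]
  have ht1 : treeWord (x + e κ - y) = treeWord hi ++ (seg κ (M : ℤ) ++ treeWord lo) := by
    rw [hoff1, ← treeWord_add_of_separated' κ hhi0 hMlo, ← treeWord_add_of_separated κ hMe hlo0, B8Lemma1NonAbelian.treeWord_zsmul_e]
  have ht2 : treeWord (x + e κ - (y + (M : ℤ) • e κ)) = treeWord hi ++ treeWord lo := by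
    rw [hoff2, ← treeWord_add_of_separated' κ hhi0 (fun j hj => hlo0 j hj.le)]
  have hdisp : disp (treeWord hi) = hi := disp_treeWord hi
  have hu1 : axialFn U y (x + e κ) = hol U y (treeWord hi) * hol U (y + hi) (seg κ (M : ℤ)) * hol U (y + hi + (M : ℤ) • e κ) (treeWord lo) := by
    rw [axialFn, ht1, hol_append, hol_append, hdisp, disp_seg, mul_assoc]
  have hu2 : axialFn U (y + (M : ℤ) • e κ) (x + e κ) = hol U (y + (M : ℤ) • e κ) (treeWord hi) * hol U (y + hi + (M : ℤ) • e κ) (treeWord lo) := by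
    rw [axialFn, ht2, hol_append, hdisp, show y + (M : ℤ) • e κ + hi = y + hi + (M : ℤ) • e κ by abel]
  rw [hu1, hu2, hdisp]
  group

end Gauge

/-! ## §3 The `M`-rung ladder letter: `‖U(A)·U(seg_M)·U(A)⁻¹·U(seg_M)⁻¹ − 1‖ ≤ M·|A|·ε` -/

section PiLoop

variable {𝔸 : Type*} [NormedRing 𝔸] [NormOneClass 𝔸]

/-- **THE `m`-RUNG LADDER LETTER** (non-abelian Stokes for the loop `A ∪ [·, · + me_κ] ∪ (−A) ∪ (−[·, · + me_κ])`): for a word `A` without `κ`-letters and a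
configuration with plaquette radius `ε`, `‖U(y; A)·U(y + disp A; seg_κ m)·U(y + me_κ; A)⁻¹·U(y; seg_κ m)⁻¹ − 1‖ ≤ m·|A|·ε` — induction on `m`, each rung a conjugated
`B7Prop1Explicit.ladder_bound`. [folklore] -/
theorem norm_piLoop_sub_one_le (U : Site (d + 1) → Fin (d + 1) → 𝔸ˣ) (hU : ∀ x κ, U x κ ∈ U1 𝔸) {ε : ℝ} (hε : 0 ≤ ε)
    (h44 : ∀ (x : Site (d + 1)) (κ μ : Fin (d + 1)), κ ≠ μ → ‖((hol U x (plaqWord κ μ) : 𝔸ˣ) : 𝔸) - 1‖ ≤ ε)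
    (κ : Fin (d + 1)) (A : List (Letter (d + 1))) (hA : ∀ l ∈ A, l.1 ≠ κ) (y : Site (d + 1)) :
    ∀ m : ℕ, ‖((hol U y A * hol U (y + disp A) (seg κ (m : ℤ)) * (hol U (y + (m : ℤ) • e κ) A)⁻¹ * (hol U y (seg κ (m : ℤ)))⁻¹ : 𝔸ˣ) : 𝔸) - 1‖
      ≤ (m : ℝ) * A.length * ε
  | 0 => by
      rw [Nat.cast_zero, seg_zero, hol_nil, hol_nil, mul_one, zero_smul, add_zero, mul_inv_cancel, inv_one, mul_one, Units.val_one, sub_self,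
        norm_zero, Nat.cast_zero, zero_mul, zero_mul]
  | m + 1 => by
      have ih := norm_piLoop_sub_one_le U hU hε h44 κ A hA y m
      -- the loop with `m + 1` rungs = (loop with `m` rungs) · (ladder at `y + me_κ` conjugated by `U(y; seg_κ m)`)
      have hseg1 : hol U (y + disp A) (seg κ ((m + 1 : ℕ) : ℤ)) = hol U (y + disp A) (seg κ (m : ℤ)) * U (y + (m : ℤ) • e κ + disp A) κ := by
        rw [Nat.cast_succ, hol_seg_natCast_succ, show y + disp A + (m : ℤ) • e κ = y + (m : ℤ) • e κ + disp A by abel]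
      have hseg2 : hol U y (seg κ ((m + 1 : ℕ) : ℤ)) = hol U y (seg κ (m : ℤ)) * U (y + (m : ℤ) • e κ) κ := by
        rw [Nat.cast_succ, hol_seg_natCast_succ]
      have hz1 : y + ((m + 1 : ℕ) : ℤ) • e κ = y + (m : ℤ) • e κ + e κ := by rw [Nat.cast_succ, add_smul, one_smul, add_assoc]
      have hid : hol U y A * hol U (y + disp A) (seg κ ((m + 1 : ℕ) : ℤ)) * (hol U (y + ((m + 1 : ℕ) : ℤ) • e κ) A)⁻¹
            * (hol U y (seg κ ((m + 1 : ℕ) : ℤ)))⁻¹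
          = (hol U y A * hol U (y + disp A) (seg κ (m : ℤ)) * (hol U (y + (m : ℤ) • e κ) A)⁻¹ * (hol U y (seg κ (m : ℤ)))⁻¹)
            * (hol U y (seg κ (m : ℤ)) * hol U (y + (m : ℤ) • e κ) (ladder A κ) * (hol U y (seg κ (m : ℤ)))⁻¹) := by
        rw [hseg1, hseg2, hz1, hol_ladder]
        group
      rw [hid, Units.val_mul]
      have hn1 : ‖((hol U y A * hol U (y + disp A) (seg κ (m : ℤ)) * (hol U (y + (m : ℤ) • e κ) A)⁻¹ * (hol U y (seg κ (m : ℤ)))⁻¹ : 𝔸ˣ) : 𝔸)‖ ≤ 1 :=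
        (mem_U1.mp ((U1 𝔸).mul_mem ((U1 𝔸).mul_mem ((U1 𝔸).mul_mem (hol_mem hU _ _) (hol_mem hU _ _))
          ((U1 𝔸).inv_mem (hol_mem hU _ _))) ((U1 𝔸).inv_mem (hol_mem hU _ _)))).1
      have hlad : ‖((hol U (y + (m : ℤ) • e κ) (ladder A κ) : 𝔸ˣ) : 𝔸) - 1‖ ≤ A.length * ε :=
        ladder_bound U hU κ (fun x l hl => norm_hol_lplaqWord_sub_one_le U hU h44 x l κ hl) A _ hA
      have hconj : ‖((hol U y (seg κ (m : ℤ)) * hol U (y + (m : ℤ) • e κ) (ladder A κ) * (hol U y (seg κ (m : ℤ)))⁻¹ : 𝔸ˣ) : 𝔸) - 1‖ ≤ A.length * ε := by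
        rw [Units.val_mul, Units.val_mul]
        exact (norm_units_conj_sub_one_le (hol_mem hU _ _) _).trans hlad
      calc _ ≤ _ + _ := B8Ineq170.norm_mul_sub_one_le_of_norm_le_one hn1
        _ ≤ (m : ℝ) * A.length * ε + A.length * ε := add_le_add ih hconj
        _ = ((m + 1 : ℕ) : ℝ) * A.length * ε := by push_cast; ring

end PiLoop

/-! ## §4 Links inside a block; links across a face versus the corner segment -/

section Links

variable {n : Type} [Fintype n] [DecidableEq n] [Nonempty n]
variable (M : ℕ) [NeZero M]

/-- **INTRA-BLOCK LINK LETTER**: if `x_κ mod M ≠ M − 1` then `‖U^{u}(x, κ) − 1‖ ≤ |x − ⌊x⌋|₁·ε ≤ (d+1)(M−1)·ε` ([B7] p. 25 l. 3 in the one-root gauge: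
`axial_bond_bound`). [folklore] -/
theorem norm_link_inside_le {U : Site (d + 1) → Fin (d + 1) → (Matrix n n ℂ)ˣ} (hU : IsUnitaryCfg U) {ε : ℝ} (hε : 0 ≤ ε) (hUε : SmallField U ε)
    (x : Site (d + 1)) (κ : Fin (d + 1)) (h : x κ % (M : ℤ) ≠ (M : ℤ) - 1) :
    ‖((gaugeAct (fun z => axialFn U (fun j => z j - z j % (M : ℤ)) z) U x κ : (Matrix n n ℂ)ˣ) : Matrix n n ℂ) - 1‖
      ≤ ((d + 1 : ℕ) : ℝ) * ((M : ℝ) - 1) * ε := by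
  have hU1 : ∀ z μ, U z μ ∈ U1 (Matrix n n ℂ) := fun z μ => mem_U1_of_unitary (hU z μ)
  rw [link_inside_eq M U x κ h]
  calc _ ≤ (l1 (x - fun j => x j - x j % (M : ℤ)) : ℝ) * ε := axial_bond_bound U hU1 _ hUε hε x κ
    _ ≤ ((d + 1 : ℕ) : ℝ) * ((M : ℝ) - 1) * ε := mul_le_mul_of_nonneg_right (l1_sub_corner_le M x) hε

/-- **FACE LINK LETTER**: if `x_κ mod M = M − 1` then `‖U^{u}(x, κ) − U^{u}(⌊x⌋; [⌊x⌋, ⌊x⌋ + Me_κ])‖ ≤ (M + 1)·(d+1)(M−1)·ε` — the face-crossing link equals the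
corner-segment transporter of its face up to the one-root link defect and an `M`-rung ladder. [folklore] -/
theorem norm_link_face_sub_seg_le {U : Site (d + 1) → Fin (d + 1) → (Matrix n n ℂ)ˣ} (hU : IsUnitaryCfg U) {ε : ℝ} (hε : 0 ≤ ε) (hUε : SmallField U ε)
    (x : Site (d + 1)) (κ : Fin (d + 1)) (h : x κ % (M : ℤ) = (M : ℤ) - 1) :
    ‖((gaugeAct (fun z => axialFn U (fun j => z j - z j % (M : ℤ)) z) U x κ : (Matrix n n ℂ)ˣ) : Matrix n n ℂ)
        - ((hol (gaugeAct (fun z => axialFn U (fun j => z j - z j % (M : ℤ)) z) U) (fun i => x i - x i % (M : ℤ)) (seg κ (M : ℤ)) : (Matrix n n ℂ)ˣ) :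
            Matrix n n ℂ)‖
      ≤ ((M : ℝ) + 1) * (((d + 1 : ℕ) : ℝ) * ((M : ℝ) - 1)) * ε := by
  have hU1 : ∀ z μ, U z μ ∈ U1 (Matrix n n ℂ) := fun z μ => mem_U1_of_unitary (hU z μ)
  rw [hol_seg_corner_eq, link_face_eq M U x κ h]
  set y : Site (d + 1) := fun j => x j - x j % (M : ℤ) with hy
  set A := treeWord (fun j => if κ < j then x j % (M : ℤ) else (0 : ℤ)) with hA
  set V₀ := gaugeAct (axialFn U y) U x κ with hV₀
  set Lp : (Matrix n n ℂ)ˣ := hol U y A * hol U (y + disp A) (seg κ (M : ℤ)) * (hol U (y + (M : ℤ) • e κ) A)⁻¹ * (hol U y (seg κ (M : ℤ)))⁻¹ with hLp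
  set S := hol U y (seg κ (M : ℤ)) with hS
  -- sizes
  have hV₀b : ‖(V₀ : Matrix n n ℂ) - 1‖ ≤ (l1 (x - y) : ℝ) * ε := axial_bond_bound U hU1 y hUε hε x κ
  have hAκ : ∀ l ∈ A, l.1 ≠ κ := by
    intro l hl hlκ
    have h0 := B8Lemma1NonAbelian.ne_zero_of_mem_treeWord hl
    rw [hlκ] at h0
    exact h0 (by simp)
  have hLpb : ‖(Lp : Matrix n n ℂ) - 1‖ ≤ (M : ℝ) * A.length * ε := norm_piLoop_sub_one_le U hU1 hε hUε κ A hAκ y M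
  have hAlen : (A.length : ℝ) ≤ (l1 (x - y) : ℝ) := by
    rw [hA, length_treeWord]
    have : l1 (fun j => if κ < j then x j % (M : ℤ) else (0 : ℤ)) ≤ l1 (x - y) := by
      unfold l1
      refine Finset.sum_le_sum fun j _ => ?_
      rw [hy, Pi.sub_apply]
      dsimp only
      split_ifs
      · simp
      · simp
    exact_mod_cast this
  have hl1 : (l1 (x - y) : ℝ) ≤ ((d + 1 : ℕ) : ℝ) * ((M : ℝ) - 1) := l1_sub_corner_le M x
  have hS1 : ‖(S : Matrix n n ℂ)‖ ≤ 1 := (mem_U1.mp (hol_mem hU1 _ _)).1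
  have hV₀1 : ‖(V₀ : Matrix n n ℂ)‖ ≤ 1 := (mem_U1.mp (gaugeAct_mem hU1 (axialFn_mem hU1 y) x κ)).1
  have hM0 : (0 : ℝ) ≤ M := Nat.cast_nonneg M
  have hl10 : (0 : ℝ) ≤ (l1 (x - y) : ℝ) := Nat.cast_nonneg _
  calc ‖((V₀ * Lp * S : (Matrix n n ℂ)ˣ) : Matrix n n ℂ) - (S : Matrix n n ℂ)‖
      = ‖(((V₀ * Lp : (Matrix n n ℂ)ˣ) : Matrix n n ℂ) - 1) * (S : Matrix n n ℂ)‖ := by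
        rw [Units.val_mul (V₀ * Lp) S, sub_mul, one_mul]
    _ ≤ ‖((V₀ * Lp : (Matrix n n ℂ)ˣ) : Matrix n n ℂ) - 1‖ * ‖(S : Matrix n n ℂ)‖ := norm_mul_le _ _
    _ ≤ ‖((V₀ * Lp : (Matrix n n ℂ)ˣ) : Matrix n n ℂ) - 1‖ := mul_le_of_le_one_right (norm_nonneg _) hS1
    _ ≤ ‖(V₀ : Matrix n n ℂ) - 1‖ + ‖(Lp : Matrix n n ℂ) - 1‖ := by
        rw [Units.val_mul]; exact B8Ineq170.norm_mul_sub_one_le_of_norm_le_one hV₀1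
    _ ≤ (l1 (x - y) : ℝ) * ε + (M : ℝ) * (l1 (x - y) : ℝ) * ε :=
        add_le_add hV₀b (hLpb.trans (mul_le_mul_of_nonneg_right (mul_le_mul_of_nonneg_left hAlen hM0) hε))
    _ = ((M : ℝ) + 1) * (l1 (x - y) : ℝ) * ε := by ring
    _ ≤ ((M : ℝ) + 1) * (((d + 1 : ℕ) : ℝ) * ((M : ℝ) - 1)) * ε :=
        mul_le_mul_of_nonneg_right (mul_le_mul_of_nonneg_left hl1 (by positivity)) hε

/-! ## §5 THE END -/

/-- **THE BLOCK-ROOTED AXIAL GAUGE ON THE PERIODIC LATTICE** (dimension `d + 1`, block side `M ≥ 1`): for unitary `P`-periodic `U` (`M ∣ P`) with plaquette radius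
`ε ≥ 0` there is a unitary `P`-periodic site gauge `u`, equal to `1` at every corner `M•y`, with: (i) `‖U^{u}(x, κ) − 1‖ ≤ (d+1)(M−1)·ε` inside blocks; (ii)
`‖U^{u}(x, κ) − U^{u}(⌊x⌋; [⌊x⌋, ⌊x⌋ + Me_κ])‖ ≤ (M+1)(d+1)(M−1)·ε` across faces; (iii) corner segments read the same in `U^{u}` and `U`. [folklore] -/
theorem exists_blockAxialGauge {U : Site (d + 1) → Fin (d + 1) → (Matrix n n ℂ)ˣ} (hU : IsUnitaryCfg U) {ε : ℝ} (hε : 0 ≤ ε)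
    (hUε : SmallField U ε) {P : ℤ} (hUP : IsPeriodicCfg U P) (hMP : (M : ℤ) ∣ P) :
    ∃ u : Site (d + 1) → (Matrix n n ℂ)ˣ,
      (∀ x, u x ∈ unitaryUnits (Matrix n n ℂ)) ∧
      (∀ (x : Site (d + 1)) (i : Fin (d + 1)), u (x + P • e i) = u x) ∧
      (∀ y : Site (d + 1), u ((M : ℤ) • y) = 1) ∧
      (∀ (x : Site (d + 1)) (κ : Fin (d + 1)), x κ % (M : ℤ) ≠ (M : ℤ) - 1 →
        ‖((gaugeAct u U x κ : (Matrix n n ℂ)ˣ) : Matrix n n ℂ) - 1‖ ≤ ((d + 1 : ℕ) : ℝ) * ((M : ℝ) - 1) * ε) ∧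
      (∀ (x : Site (d + 1)) (κ : Fin (d + 1)), x κ % (M : ℤ) = (M : ℤ) - 1 →
        ‖((gaugeAct u U x κ : (Matrix n n ℂ)ˣ) : Matrix n n ℂ)
            - ((hol (gaugeAct u U) (fun i => x i - x i % (M : ℤ)) (seg κ (M : ℤ)) : (Matrix n n ℂ)ˣ) : Matrix n n ℂ)‖
          ≤ ((M : ℝ) + 1) * (((d + 1 : ℕ) : ℝ) * ((M : ℝ) - 1)) * ε) ∧
      (∀ (x : Site (d + 1)) (κ : Fin (d + 1)),
        hol (gaugeAct u U) (fun i => x i - x i % (M : ℤ)) (seg κ (M : ℤ)) = hol U (fun i => x i - x i % (M : ℤ)) (seg κ (M : ℤ))) :=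
  ⟨fun z => axialFn U (fun j => z j - z j % (M : ℤ)) z, fun x => gauge_unitary M hU x, fun x i => gauge_periodic M hUP hMP x i,
    fun y => gauge_corner M U y, fun x κ h => norm_link_inside_le M hU hε hUε x κ h, fun x κ h => norm_link_face_sub_seg_le M hU hε hUε x κ h,
    fun x κ => hol_seg_corner_eq M U x κ⟩

end Links

end

end Summit.QuantumFields.BalabanUV.T4Continuum.NE7BlockAxialGauge
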